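import Mathlib.Algebra.Field.Basic
import Mathlib.SetTheory.Cardinal.Finite
import Mathlib.Data.Fintype.Card
import Mathlib.Tactic.Ring
import Mathlib.Tactic.FieldSimp
import Mathlib.Tactic.LinearCombination
import Mathlib.Tactic.Push
import HarnessLib

/-!
# The canonical quadratic refinement of an alternating `±1`-pairing on a Klein four-group
# (the Arf-invariant-`1` form; the `e_*`-normalisation of Mumford's theta group for an elliptic curve)

Pure algebra (topic `Literature/GroupTheory/FiniteAbelian`).  Let `T` be an additive group of exponent `2`
with exactly four elements (a Klein four-group, e.g. the `2`-torsion `E[2]` of an elliptic curve) and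
`c : T × T → R` (`R` a field) a multiplicatively bi-additive ALTERNATING pairing with values in `{±1}`.  Such a
pairing is either trivial or the unique non-degenerate one (`−1` exactly on pairs of distinct non-zero
elements, `eq_neg_one_of_ne`).  In both cases the function

  `arfSign c t = −1` if `c` is non-trivial and `t ≠ 0`, `= 1` otherwise

(the quadratic form of Arf invariant `1`, taking the value `1 ∈ 𝔽₂` at all three non-zero points, written
multiplicatively) is a QUADRATIC REFINEMENT of `c` invariant under every automorphism of `(T, c)`:

  `c(s, t) · arfSign s · arfSign t = arfSign (s + t)`      (`mul_arfSign_mul_arfSign`).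

This is the normalisation (Mumford's `e_*^L`; Morgan–Smith 2021, Def. 5.19, the function `e : M[2] → ±1` with
`e(x+y) e(x)⁻¹ e(y)⁻¹ = P₁(x, y)`) that cuts a `μₙ`-valued theta group of an elliptic curve out of the
`K̄ˣ`-valued one at EVEN level, where no bilinear square root of the commutator pairing exists; for an
elliptic curve it is available canonically because `dim_{𝔽₂} E[2] = 2` (for abelian varieties of higher
dimension the analogous refinement need not be Galois invariant: Poonen–Stoll's obstruction).
References: D. Mumford, *On the equations defining abelian varieties I*, Invent. Math. 1 (1966) §2 (`e_*^L`);
[MorganSmith2021CTP] §5.3 Def. 5.19; [PoonenRains2012] §4.1.  Elementary, complete proofs, no named fact.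
-/

set_option autoImplicit false

open scoped Classical

namespace Literature.GroupTheory.FiniteAbelian

universe u v

variable {T : Type u} [AddCommGroup T] {R : Type v} [Field R]

/-- **The Arf-invariant-`1` sign function** of a `±1`-valued pairing `c` on `T`: `−1` on the non-zero elements
if `c` is non-trivial, identically `1` if `c` is trivial. [cite: MorganSmith2021CTP, §5.3 Def. 5.19 (the function e : M[2] → ±1)] -/
noncomputable def arfSign (c : T → T → R) (t : T) : R :=
  if (∃ s t', c s t' ≠ 1) ∧ t ≠ 0 then -1 else 1

/-- `arfSign c 0 = 1`. [cite: MorganSmith2021CTP, §5.3 Def. 5.19 (the function e : M[2] → ±1)] -/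
@[simp] theorem arfSign_zero (c : T → T → R) : arfSign c 0 = 1 := by
  unfold arfSign
  rw [if_neg]
  exact fun h => h.2 rfl

/-- `arfSign c t = ±1`. [cite: MorganSmith2021CTP, §5.3 Def. 5.19 (the function e : M[2] → ±1)] -/
theorem arfSign_eq_one_or (c : T → T → R) (t : T) : arfSign c t = 1 ∨ arfSign c t = -1 := by
  unfold arfSign
  split_ifs
  · exact Or.inr rfl
  · exact Or.inl rfl

/-- `arfSign c t · arfSign c t = 1`. [cite: MorganSmith2021CTP, §5.3 Def. 5.19 (the function e : M[2] → ±1)] -/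
theorem arfSign_mul_self (c : T → T → R) (t : T) : arfSign c t * arfSign c t = 1 := by
  rcases arfSign_eq_one_or c t with h | h <;> rw [h] <;> ring

/-- `arfSign c t ≠ 0`. [cite: MorganSmith2021CTP, §5.3 Def. 5.19 (the function e : M[2] → ±1)] -/
theorem arfSign_ne_zero (c : T → T → R) (t : T) : arfSign c t ≠ 0 := fun h => by
  have := arfSign_mul_self c t
  rw [h, mul_zero] at this
  exact zero_ne_one this

/-- For a trivial pairing `arfSign ≡ 1`. [cite: MorganSmith2021CTP, §5.3 Def. 5.19 (the function e : M[2] → ±1)] -/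
theorem arfSign_of_trivial {c : T → T → R} (hc : ∀ s t, c s t = 1) (t : T) : arfSign c t = 1 := by
  unfold arfSign
  rw [if_neg]
  rintro ⟨⟨s, t', h⟩, -⟩
  exact h (hc s t')

/-- For a non-trivial pairing `arfSign t = −1` exactly at `t ≠ 0`. [cite: MorganSmith2021CTP, §5.3 Def. 5.19 (the function e : M[2] → ±1)] -/
theorem arfSign_of_nontrivial {c : T → T → R} (hc : ∃ s t', c s t' ≠ 1) {t : T} (ht : t ≠ 0) : arfSign c t = -1 := by
  unfold arfSign
  rw [if_pos ⟨hc, ht⟩]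

/-- `arfSign c` depends on its argument only through the predicate `· = 0` (so it is invariant under any
zero-preserving bijection, e.g. a Galois automorphism of `E[2]`). [cite: MorganSmith2021CTP, §5.3 Def. 5.19 (G_F-equivariance of e)] -/
theorem arfSign_congr (c : T → T → R) {t t' : T} (h : t = 0 ↔ t' = 0) : arfSign c t = arfSign c t' := by
  unfold arfSign
  have h' : ((∃ s u, c s u ≠ 1) ∧ t ≠ 0) ↔ ((∃ s u, c s u ≠ 1) ∧ t' ≠ 0) := and_congr Iff.rfl (not_congr h)
  by_cases h1 : (∃ s u, c s u ≠ 1) ∧ t ≠ 0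
  · rw [if_pos h1, if_pos (h'.mp h1)]
  · rw [if_neg h1, if_neg (fun h2 => h1 (h'.mpr h2))]

section Klein

variable (c : T → T → R) (halt : ∀ t, c t t = 1)
  (hadd₁ : ∀ s s' t, c (s + s') t = c s t * c s' t) (hadd₂ : ∀ s t t', c s (t + t') = c s t * c s t')
  (hpm : ∀ s t, c s t = 1 ∨ c s t = -1)

include hadd₁ hpm in
/-- `c(0, t) = 1`. [cite: MorganSmith2021CTP, §5.3 Def. 5.19 (bi-additivity of P₁)] -/
theorem pairing_zero_left (t : T) : c 0 t = 1 := by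
  have h := hadd₁ 0 0 t
  rw [add_zero] at h
  have hne : c 0 t ≠ 0 := by
    rcases hpm 0 t with h1 | h1 <;> rw [h1]
    · exact one_ne_zero
    · exact neg_ne_zero.mpr one_ne_zero
  exact (mul_eq_left₀ hne).mp h.symm

include hadd₂ hpm in
/-- `c(s, 0) = 1`. [cite: MorganSmith2021CTP, §5.3 Def. 5.19 (bi-additivity of P₁)] -/
theorem pairing_zero_right (s : T) : c s 0 = 1 := by
  have h := hadd₂ s 0 0
  rw [add_zero] at h
  have hne : c s 0 ≠ 0 := by
    rcases hpm s 0 with h1 | h1 <;> rw [h1]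
    · exact one_ne_zero
    · exact neg_ne_zero.mpr one_ne_zero
  exact (mul_eq_left₀ hne).mp h.symm

include halt hadd₁ hadd₂ hpm in
/-- An alternating bi-additive `±1`-pairing is symmetric: `c(t, s) = c(s, t)` (from `c(s+t, s+t) = 1`). [cite: MorganSmith2021CTP, §5.3 Def. 5.19 (P₁ antisymmetric)] -/
theorem pairing_swap (s t : T) : c t s = c s t := by
  have h := halt (s + t)
  rw [hadd₁, hadd₂, hadd₂, halt, halt, one_mul, mul_one] at h
  -- h : c s t * c t s = 1
  rcases hpm s t with h1 | h1
  · rw [h1, one_mul] at h; rw [h, h1]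
  · rw [h1] at h ⊢
    linear_combination (-1 : R) * h

variable (hexp : ∀ t : T, t + t = 0) (hcard : Nat.card T = 4)

include hexp hcard in
/-- **A Klein four-group is `{0, s, t, s+t}`** for any two distinct non-zero `s, t` (as `E[2] ≅ (ℤ/2)²`). [cite: SilvermanAEC2009, Cor. III.6.4(b) (E[m] ≅ ℤ/m × ℤ/m)] -/
theorem klein_cases {s t : T} (hs : s ≠ 0) (ht : t ≠ 0) (hst : s ≠ t) (u : T) :
    u = 0 ∨ u = s ∨ u = t ∨ u = s + t := by
  classical
  haveI : Finite T := Nat.finite_of_card_ne_zero (by rw [hcard]; norm_num)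
  letI : Fintype T := Fintype.ofFinite T
  have hcard' : Fintype.card T = 4 := by rw [← Nat.card_eq_fintype_card, hcard]
  have hneg : ∀ x : T, -x = x := fun x => neg_eq_of_add_eq_zero_right (hexp x)
  have h1 : s + t ≠ 0 := fun h => by
    have : s = -t := eq_neg_of_add_eq_zero_left h
    rw [hneg] at this
    exact hst this
  have h2 : s + t ≠ s := fun h => ht (by simpa using h)
  have h3 : s + t ≠ t := fun h => hs (by simpa using h)
  let S : Finset T := {0, s, t, s + t}
  have hS : S.card = 4 := by
    simp only [S]
    rw [Finset.card_insert_of_notMem, Finset.card_insert_of_notMem, Finset.card_insert_of_notMem,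
      Finset.card_singleton]
    · simp only [Finset.mem_singleton]; exact fun h => h3 h.symm
    · simp only [Finset.mem_insert, Finset.mem_singleton, not_or]; exact ⟨hst, fun h => h2 h.symm⟩
    · simp only [Finset.mem_insert, Finset.mem_singleton, not_or]; exact ⟨hs.symm, ht.symm, h1.symm⟩
  have hSu : S = Finset.univ := Finset.eq_univ_of_card S (by rw [hS, hcard'])
  have hu : u ∈ S := by rw [hSu]; exact Finset.mem_univ u
  simpa only [S, Finset.mem_insert, Finset.mem_singleton] using hu

include halt hadd₁ hadd₂ hpm hexp hcard in
/-- **A non-trivial alternating `±1`-pairing on a Klein four-group is the non-degenerate one**: `c(s, t) = −1`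
for all distinct non-zero `s, t` (the Weil pairing `e₂` on `E[2]`). [cite: SilvermanAEC2009, Prop. III.8.1 (e_m alternating and non-degenerate)] -/
theorem eq_neg_one_of_ne (hc : ∃ a b, c a b ≠ 1) {s t : T} (hs : s ≠ 0) (ht : t ≠ 0) (hst : s ≠ t) :
    c s t = -1 := by
  rcases hpm s t with h1 | h1
  · exfalso
    obtain ⟨a, b, hab⟩ := hc
    -- `c` is trivial on `{s, t, s+t}`, hence everywhere
    have hsw := pairing_swap c halt hadd₁ hadd₂ hpm
    have v1 : c t s = 1 := by rw [hsw, h1]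
    have v2 : c s (s + t) = 1 := by rw [hadd₂, halt, h1, one_mul]
    have v3 : c (s + t) s = 1 := by rw [hsw, v2]
    have v4 : c t (s + t) = 1 := by rw [hadd₂, v1, halt, one_mul]
    have v5 : c (s + t) t = 1 := by rw [hsw, v4]
    have hz1 := pairing_zero_left c hadd₁ hpm
    have hz2 := pairing_zero_right c hadd₂ hpm
    apply hab
    rcases klein_cases hexp hcard hs ht hst a with rfl | rfl | rfl | rfl <;>
      rcases klein_cases hexp hcard hs ht hst b with rfl | rfl | rfl | rfl <;>
      first | exact hz1 _ | exact hz2 _ | exact halt _ | assumption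
  · exact h1

include halt hadd₁ hadd₂ hpm hexp hcard in
/-- **`arfSign` is a quadratic refinement of `c`**: `c(s, t) · arfSign s · arfSign t = arfSign (s + t)` for all
`s, t` — the Arf-invariant-`1` form refines the (trivial or non-degenerate) alternating pairing of a Klein
four-group. [cite: MorganSmith2021CTP, §5.3 Def. 5.19 (e(x+y) e(x)⁻¹ e(y)⁻¹ = P₁(x, y))] -/
theorem mul_arfSign_mul_arfSign (s t : T) : c s t * arfSign c s * arfSign c t = arfSign c (s + t) := by
  by_cases hc : ∃ a b, c a b ≠ 1
  · have hz1 := pairing_zero_left c hadd₁ hpm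
    have hz2 := pairing_zero_right c hadd₂ hpm
    by_cases hs : s = 0
    · subst hs
      rw [hz1, zero_add, arfSign_zero, one_mul, one_mul]
    by_cases ht : t = 0
    · subst ht
      rw [hz2, add_zero, arfSign_zero, one_mul, mul_one]
    by_cases hst : s = t
    · subst hst
      rw [halt, hexp, arfSign_zero, one_mul, arfSign_mul_self]
    · have hsum : s + t ≠ 0 := fun h => by
        have h' : s = -t := eq_neg_of_add_eq_zero_left h
        have hn : -t = t := neg_eq_of_add_eq_zero_right (hexp t)
        rw [hn] at h'
        exact hst h'
      rw [eq_neg_one_of_ne c halt hadd₁ hadd₂ hpm hexp hcard hc hs ht hst, arfSign_of_nontrivial hc hs,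
        arfSign_of_nontrivial hc ht, arfSign_of_nontrivial hc hsum]
      ring
  · push Not at hc
    rw [hc, arfSign_of_trivial hc, arfSign_of_trivial hc, arfSign_of_trivial hc]
    ring

end Klein

end Literature.GroupTheory.FiniteAbelian
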